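import Summits.PneNP.PneNP.Theorems.CodingVolumeShiftsCodingVolumeRungs
import Summits.PneNP.PneNP.Theorems.CodingVolumeShiftsCodingVolumeLinearLabels

/-!
# Route CodingVolumeShifts — crux `CodingVolume` (stmt-PneNP-19454): the DEPARTURE lemma for
# linear one-shot codes

Part 3 of the `C = 4` rung for LINEAR one-shot codes. Setting: a k-pairs network `N`, a labelling
`φ : N.A → (K^ι)^*` with LOCALITY/DECODABILITY (see `CodingVolumeShiftsCodingVolumeLinearLabels`),
and for every commodity `i` the LEVEL `hr i` — the least rank of a middle vertex receiving an
effective (non-zero) arc from `source i` (here only its minimality `hhr` is assumed). Fix a level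
`r`, a coordinate-killing map `f` killing the coordinates of level `< r` ("modulo what entered the
middle of the network earlier"), a set `A1` of level-`r` commodities each entering the middle of the
network at a SINGLE vertex (all its effective arcs into middle vertices have the same head), and the
projection `g` onto the coordinates `A1`.

* `codingVolume_level_out_support` — a label leaving a middle vertex `u` of rank `r`, taken modulo
  level `< r`, is supported on the commodities with an effective arc into `u`; after projecting to
  `A1`, on the BLOCK of `u` (the `A1`-commodities entering at `u`).
* `codingVolume_level_lemmaM` — every label with a middle tail of rank `> r`, modulo level `< r` and
  projected to `A1`, lies in `Tgt` := the projected span of the labels on arcs from rank-`r` middle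
  vertices to middle vertices (rank induction on LOCALITY).
* `codingVolume_level_departure` — **DEPARTURE**: for a `4`-far network, every coordinate
  functional `proj i`, `i ∈ A1`, lies in `Tgt`: decode at `sink i`, chase the labels back with
  Lemma M, and project onto the block of the entry vertex of `i` — foreign blocks die, and a source of
  the same block adjacent to `sink i` would put `source i` at distance `3` from `sink i`.

No definitions; all sets are spelled out. [folklore]-level linear algebra throughout.
-/

set_option linter.dupNamespace false -- `Summit.PneNP.PneNP.…`: summit = sub-problem name (D-0017)

namespace Summit.PneNP.PneNP.Theorems

open Literature.InformationTheory.NetworkCoding Module Submodule Finset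

section Level

variable {K : Type*} [Field K] {ι : Type} [Fintype ι] [DecidableEq ι] {N : KPairsNet ι}
  {φ : N.A → Module.Dual K (ι → K)}

omit [DecidableEq ι] in
/-- OUT-SUPPORT AT LEVEL `r`. A label leaving a middle vertex `u` of rank `r` lies in the span of
the coordinate functionals of the commodities with an effective arc into `u`, together with those of
level `< r` (LOCALITY at `u`: its in-labels come from sources — multiples of their coordinates — or
from middle vertices of smaller rank, whose labels only involve levels `< r` by the support lemma and
the minimality of levels). [folklore] -/
theorem codingVolume_level_out_support
    (hloc : ∀ b, φ b ∈ span K (φ '' ↑(N.inArcs (N.src b)) ∪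
      (fun i => (LinearMap.proj i : Module.Dual K (ι → K))) '' {i | N.source i = N.src b}))
    (hr : ι → ℕ)
    (hhr : ∀ i a, N.src a = N.source i → (∀ l, N.tgt a ≠ N.sink l) → φ a ≠ 0 →
      hr i ≤ N.rank (N.tgt a))
    (r : ℕ) (b : N.A) (hbM : ∀ j, N.src b ≠ N.source j) (hbr : N.rank (N.src b) = r) :
    φ b ∈ span K ((fun i => (LinearMap.proj i : Module.Dual K (ι → K))) ''
      ({j | ∃ a, N.src a = N.source j ∧ N.tgt a = N.src b ∧ φ a ≠ 0} ∪ {j | hr j < r})) := by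
  have h := hloc b
  have hsrc : {i | N.source i = N.src b} = ∅ := by
    ext i
    simp only [Set.mem_setOf_eq, Set.mem_empty_iff_false, iff_false]
    exact fun hi => hbM i hi.symm
  rw [hsrc, Set.image_empty, Set.union_empty] at h
  refine (span_le.mpr ?_) h
  rintro ψ ⟨a, ha, rfl⟩
  simp only [Finset.mem_coe, KPairsNet.inArcs, Finset.mem_filter, Finset.mem_univ, true_and] at ha
  by_cases hsa : ∃ j, N.src a = N.source j
  · obtain ⟨j, hj⟩ := hsa
    by_cases hz : φ a = 0
    · rw [hz]; exact zero_mem _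
    · refine span_mono (Set.image_mono Set.subset_union_left) ?_
      have hjmem : j ∈ {j | ∃ a, N.src a = N.source j ∧ N.tgt a = N.src b ∧ φ a ≠ 0} :=
        ⟨a, hj, ha, hz⟩
      exact span_mono (Set.singleton_subset_iff.mpr (Set.mem_image_of_mem _ hjmem))
        (codingVolume_label_source hloc a hj)
  · push Not at hsa
    -- `a` leaves a middle vertex of rank `< r`
    have hlt : N.rank (N.src a) < r := by rw [← hbr, ← ha]; exact N.rank_lt a
    cases r with
    | zero => exact absurd hlt (Nat.not_lt_zero _)
    | succ r' =>
      have hsup := codingVolume_label_support hloc r' a hsa (Nat.lt_succ_iff.mp hlt)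
      refine span_mono (Set.image_mono ?_) hsup
      rintro j ⟨a', ha', hM', hrk, hz'⟩
      exact Or.inr (Nat.lt_succ_of_le ((hhr j a' ha' hM' hz').trans hrk))

/-- The same label modulo level `< r` (after a coordinate-killing map `f` for `{j | hr j < r}`) and
projected onto a set `A1` of commodities (a coordinate-killing map `g` for the complement of `A1`) is
supported on the BLOCK of its tail: the commodities of `A1` with an effective arc into it.
[folklore] -/
theorem codingVolume_level_out_block
    (hloc : ∀ b, φ b ∈ span K (φ '' ↑(N.inArcs (N.src b)) ∪
      (fun i => (LinearMap.proj i : Module.Dual K (ι → K))) '' {i | N.source i = N.src b}))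
    (hr : ι → ℕ)
    (hhr : ∀ i a, N.src a = N.source i → (∀ l, N.tgt a ≠ N.sink l) → φ a ≠ 0 →
      hr i ≤ N.rank (N.tgt a))
    (r : ℕ) {f g : Module.Dual K (ι → K) →ₗ[K] Module.Dual K (ι → K)}
    (hf : ∀ i, f (LinearMap.proj i) = if i ∈ {j | hr j < r} then 0 else LinearMap.proj i)
    (A1 : Finset ι)
    (hg : ∀ i, g (LinearMap.proj i) = if i ∈ {j | j ∉ A1} then 0 else LinearMap.proj i)
    (b : N.A) (hbM : ∀ j, N.src b ≠ N.source j) (hbr : N.rank (N.src b) = r) :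
    g (f (φ b)) ∈ span K ((fun i => (LinearMap.proj i : Module.Dual K (ι → K))) ''
      {j | j ∈ A1 ∧ ∃ a, N.src a = N.source j ∧ N.tgt a = N.src b ∧ φ a ≠ 0}) := by
  classical
  have h1 := codingVolume_level_out_support hloc hr hhr r b hbM hbr
  have h2 : f (φ b) ∈ _ := codingVolume_kill_map_span_le hf _ (mem_map_of_mem h1)
  have h3 : g (f (φ b)) ∈ _ := codingVolume_kill_map_span_le hg _ (mem_map_of_mem h2)
  refine span_mono (Set.image_mono ?_) h3
  rintro j ⟨⟨hj, hjr⟩, hjA⟩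
  simp only [Set.mem_setOf_eq, not_not] at hjA hjr
  rcases hj with hj | hj
  · exact ⟨hjA, hj⟩
  · exact absurd hj hjr

/-- **LEMMA M (rank induction).** With `f`, `g`, `A1` as above, suppose every commodity of `A1`
has all its effective arcs into middle vertices landing in a vertex of rank `r`. Then for every arc
`b` whose tail is a middle vertex of rank `> r`, `g (f (φ b))` lies in `Tgt`, the image under
`g ∘ f` of the span of the labels on arcs from rank-`r` middle vertices INTO MIDDLE VERTICES:
in-labels of the tail come from lower middle vertices (rank `< r`: killed by `f`; `= r`: generators
of `Tgt`; `> r`: induction) or from sources `j` (killed by `g` unless `j ∈ A1`, and an `A1`-source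
has no effective arc into a vertex of rank `> r`). [folklore] -/
theorem codingVolume_level_lemmaM
    (hloc : ∀ b, φ b ∈ span K (φ '' ↑(N.inArcs (N.src b)) ∪
      (fun i => (LinearMap.proj i : Module.Dual K (ι → K))) '' {i | N.source i = N.src b}))
    (hr : ι → ℕ)
    (hhr : ∀ i a, N.src a = N.source i → (∀ l, N.tgt a ≠ N.sink l) → φ a ≠ 0 →
      hr i ≤ N.rank (N.tgt a))
    (r : ℕ) {f g : Module.Dual K (ι → K) →ₗ[K] Module.Dual K (ι → K)}
    (hf : ∀ i, f (LinearMap.proj i) = if i ∈ {j | hr j < r} then 0 else LinearMap.proj i)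
    (A1 : Finset ι)
    (hg : ∀ i, g (LinearMap.proj i) = if i ∈ {j | j ∉ A1} then 0 else LinearMap.proj i)
    (hA1 : ∀ j ∈ A1, ∀ a, N.src a = N.source j → (∀ l, N.tgt a ≠ N.sink l) → φ a ≠ 0 →
      N.rank (N.tgt a) = r)
    (b : N.A) (hbM : ∀ j, N.src b ≠ N.source j) (hbr : r < N.rank (N.src b)) :
    g (f (φ b)) ∈ (span K (φ '' {a | (∀ j, N.tgt a ≠ N.source j) ∧ (∀ j, N.tgt a ≠ N.sink j) ∧
      (∀ j, N.src a ≠ N.source j) ∧ N.rank (N.src a) = r})).map (g.comp f) := by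
  classical
  set Tgt := (span K (φ '' {a | (∀ j, N.tgt a ≠ N.source j) ∧ (∀ j, N.tgt a ≠ N.sink j) ∧
      (∀ j, N.src a ≠ N.source j) ∧ N.rank (N.src a) = r})).map (g.comp f) with hTgt
  suffices h : ∀ (q : ℕ) (b : N.A), N.rank (N.src b) = q → (∀ j, N.src b ≠ N.source j) →
      r < N.rank (N.src b) → g (f (φ b)) ∈ Tgt from h _ b rfl hbM hbr
  intro q
  induction q using Nat.strong_induction_on with
  | _ q ih =>
    intro b hq hbM hbr
    have h := hloc b
    have hsrc : {i | N.source i = N.src b} = ∅ := by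
      ext i
      simp only [Set.mem_setOf_eq, Set.mem_empty_iff_false, iff_false]
      exact fun hi => hbM i hi.symm
    rw [hsrc, Set.image_empty, Set.union_empty] at h
    -- push the membership through the linear map `g ∘ f`
    have hgf : g (f (φ b)) = (g.comp f) (φ b) := rfl
    rw [hgf]
    refine (span_le.mpr ?_ : span K (φ '' ↑(N.inArcs (N.src b))) ≤ Tgt.comap (g.comp f)) h
    rintro ψ ⟨a, ha, rfl⟩
    simp only [Finset.mem_coe, KPairsNet.inArcs, Finset.mem_filter, Finset.mem_univ, true_and]
      at ha
    rw [SetLike.mem_coe, mem_comap, LinearMap.comp_apply]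
    by_cases hsa : ∃ j, N.src a = N.source j
    · -- from a source `j`: a multiple of `proj j`
      obtain ⟨j, hj⟩ := hsa
      by_cases hz : φ a = 0
      · rw [hz, map_zero, map_zero]; exact zero_mem _
      have hφa := codingVolume_label_source hloc a hj
      rw [mem_span_singleton] at hφa
      obtain ⟨c0, hc0⟩ := hφa
      rw [← hc0, map_smul, map_smul]
      refine smul_mem _ _ ?_
      rw [hf j]
      by_cases hjr : j ∈ {j | hr j < r}
      · rw [if_pos hjr, map_zero]; exact zero_mem _
      · rw [if_neg hjr, hg j]
        by_cases hjA : j ∈ {j | j ∉ A1}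
        · rw [if_pos hjA]; exact zero_mem _
        · -- `j ∈ A1` with an effective arc into `src b` of rank `> r`: impossible
          exfalso
          simp only [Set.mem_setOf_eq, not_not] at hjA
          have hM : ∀ l, N.tgt a ≠ N.sink l := fun l hl => N.sink_out b l (ha.symm.trans hl)
          have := hA1 j hjA a hj hM hz
          rw [ha, hq] at this
          omega
    · push Not at hsa
      -- from a middle vertex `p = src a`
      rcases lt_trichotomy (N.rank (N.src a)) r with hlt | heq | hgt
      · -- rank `< r`: the label only involves levels `< r`, killed by `f`
        have hsup : φ a ∈ span K ((fun i => (LinearMap.proj i : Module.Dual K (ι → K))) ''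
            {j | hr j < r}) := by
          cases r with
          | zero => exact absurd hlt (Nat.not_lt_zero _)
          | succ r' =>
            refine span_mono (Set.image_mono ?_)
              (codingVolume_label_support hloc r' a hsa (Nat.lt_succ_iff.mp hlt))
            rintro j ⟨a', ha', hM', hrk, hz'⟩
            exact Nat.lt_succ_of_le ((hhr j a' ha' hM' hz').trans hrk)
        rw [codingVolume_kill_eq_zero_of_mem_span hf subset_rfl hsup, map_zero]
        exact zero_mem _
      · -- rank `= r`: a generator of `Tgt` (its head `src b` is a middle vertex)
        refine mem_map_of_mem (subset_span ⟨a, ⟨?_, ?_, hsa, heq⟩, rfl⟩)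
        · intro j hj; exact hbM j (ha ▸ hj)
        · intro j hj; exact N.sink_out b j (ha.symm.trans hj)
      · -- rank `> r`: induction
        have hlt : N.rank (N.src a) < q := by rw [← hq, ← ha]; exact N.rank_lt a
        exact ih _ hlt a rfl hsa hgt

/-- **DEPARTURE LEMMA.** Let `f` kill the coordinates of level `< r`, let `A1` be a set of
level-`r` commodities each of which enters the middle of the network through effective arcs into ONE
middle vertex only (its entry vertex, of rank `r`), and let `g` project onto the coordinates `A1`. In
a `4`-far network, for every `i ∈ A1` the coordinate functional `proj i` lies in `Tgt`, the image
under `g ∘ f` of the span of the labels on arcs from rank-`r` middle vertices into middle vertices: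
all the information of the `A1`-commodities must DEPART from their entry vertices along such arcs.
Proof: decode `proj i` at `sink i` and apply `h ∘ g ∘ f`, where `h` projects onto the BLOCK of the
entry vertex `u` of `i` (the `A1`-commodities entering at `u`); labels out of other rank-`r` vertices
live on other blocks and die, labels of higher rank are in `Tgt` by Lemma M and `h` maps `Tgt` into
itself, and a source of the block of `u` adjacent to `sink i`, or an arc `u → sink i`, would put
`source i` within distance `3` of `sink i`. [folklore] -/
theorem codingVolume_level_departure
    (hloc : ∀ b, φ b ∈ span K (φ '' ↑(N.inArcs (N.src b)) ∪
      (fun i => (LinearMap.proj i : Module.Dual K (ι → K))) '' {i | N.source i = N.src b}))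
    (hdec : ∀ i, (LinearMap.proj i : Module.Dual K (ι → K)) ∈
      span K (φ '' ↑(N.inArcs (N.sink i))))
    (hr : ι → ℕ)
    (hhr : ∀ i a, N.src a = N.source i → (∀ l, N.tgt a ≠ N.sink l) → φ a ≠ 0 →
      hr i ≤ N.rank (N.tgt a))
    (r : ℕ) {f g : Module.Dual K (ι → K) →ₗ[K] Module.Dual K (ι → K)}
    (hf : ∀ i, f (LinearMap.proj i) = if i ∈ {j | hr j < r} then 0 else LinearMap.proj i)
    (A1 : Finset ι)
    (hg : ∀ i, g (LinearMap.proj i) = if i ∈ {j | j ∉ A1} then 0 else LinearMap.proj i)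
    (hA1r : ∀ j ∈ A1, hr j = r)
    (hA1 : ∀ j ∈ A1, ∀ a, N.src a = N.source j → (∀ l, N.tgt a ≠ N.sink l) → φ a ≠ 0 →
      N.rank (N.tgt a) = r)
    (hA1u : ∀ j ∈ A1, ∀ a a', N.src a = N.source j → N.src a' = N.source j →
      (∀ l, N.tgt a ≠ N.sink l) → (∀ l, N.tgt a' ≠ N.sink l) → φ a ≠ 0 → φ a' ≠ 0 →
      N.tgt a = N.tgt a')
    (hA1e : ∀ j ∈ A1, ∃ a, N.src a = N.source j ∧ (∀ l, N.tgt a ≠ N.sink l) ∧ φ a ≠ 0)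
    (hfar : N.Far 4) (i : ι) (hi : i ∈ A1) :
    (LinearMap.proj i : Module.Dual K (ι → K)) ∈
      (span K (φ '' {a | (∀ j, N.tgt a ≠ N.source j) ∧ (∀ j, N.tgt a ≠ N.sink j) ∧
        (∀ j, N.src a ≠ N.source j) ∧ N.rank (N.src a) = r})).map (g.comp f) := by
  classical
  set Tgt := (span K (φ '' {a | (∀ j, N.tgt a ≠ N.source j) ∧ (∀ j, N.tgt a ≠ N.sink j) ∧
      (∀ j, N.src a ≠ N.source j) ∧ N.rank (N.src a) = r})).map (g.comp f) with hTgt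
  -- the entry arc and entry vertex of `i`
  obtain ⟨ai, hai, haiM, haiz⟩ := hA1e i hi
  set u := N.tgt ai with hu
  have huM : ∀ j, u ≠ N.source j := fun j h => N.source_in ai j h
  -- the block of `u` and the projection `h` onto it
  set Blk : Set ι := {j | j ∈ A1 ∧ ∃ a, N.src a = N.source j ∧ N.tgt a = u ∧ φ a ≠ 0} with hBlk
  have hiBlk : i ∈ Blk := ⟨hi, ai, hai, rfl, haiz⟩
  obtain ⟨h, hh⟩ := codingVolume_exists_kill (K := K) {j | j ∉ Blk}
  -- labels out of a rank-`r` middle vertex `p`: fixed by `h` if `p = u`, killed otherwise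
  have hblock : ∀ b, (∀ j, N.src b ≠ N.source j) → N.rank (N.src b) = r →
      (N.src b = u → h (g (f (φ b))) = g (f (φ b))) ∧ (N.src b ≠ u → h (g (f (φ b))) = 0) := by
    intro b hbM hbr
    have hsup := codingVolume_level_out_block hloc hr hhr r hf A1 hg b hbM hbr
    constructor
    · intro hbu
      refine codingVolume_kill_eq_self_of_mem_span hh ?_ hsup
      rw [Set.disjoint_left]
      rintro j ⟨hjA, a, ha, hat, hz⟩ hjn
      exact hjn ⟨hjA, a, ha, hat.trans hbu, hz⟩
    · intro hbu
      refine codingVolume_kill_eq_zero_of_mem_span hh ?_ hsup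
      rintro j ⟨hjA, a, ha, hat, hz⟩ ⟨-, a', ha', hat', hz'⟩
      -- `j ∈ A1` enters both at `src b` and at `u`: same vertex
      have hM : ∀ l, N.tgt a ≠ N.sink l := fun l hl => N.sink_out b l (hat.symm.trans hl)
      have hM' : ∀ l, N.tgt a' ≠ N.sink l := fun l hl => haiM l (by rw [← hl, hat', hu])
      exact hbu (hat.symm.trans ((hA1u j hjA a a' ha ha' hM hM' hz hz').trans hat'))
  -- `h` maps `Tgt` into itself
  have hTgt_h : ∀ x ∈ Tgt, h x ∈ Tgt := by
    intro x hx
    rw [hTgt, Submodule.mem_map] at hx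
    obtain ⟨y, hy, rfl⟩ := hx
    induction hy using span_induction with
    | mem z hz =>
      obtain ⟨b, ⟨hb1, hb2, hb3, hb4⟩, rfl⟩ := hz
      rw [LinearMap.comp_apply]
      by_cases hbu : N.src b = u
      · rw [(hblock b hb3 hb4).1 hbu]
        exact mem_map_of_mem (subset_span ⟨b, ⟨hb1, hb2, hb3, hb4⟩, rfl⟩)
      · rw [(hblock b hb3 hb4).2 hbu]; exact zero_mem _
    | zero => rw [map_zero, map_zero]; exact zero_mem _
    | add x y _ _ hx hy => rw [map_add, map_add]; exact add_mem hx hy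
    | smul c x _ hx => rw [map_smul, map_smul]; exact smul_mem _ _ hx
  -- `(h ∘ g ∘ f) (proj i) = proj i`
  have hfix : h (g (f (LinearMap.proj i))) = (LinearMap.proj i : Module.Dual K (ι → K)) := by
    rw [hf i, if_neg (by simp [hA1r i hi]), hg i, if_neg (by simp [hi]), hh i, if_neg (by
      simp only [Set.mem_setOf_eq, not_not]; exact hiBlk)]
  -- distances: no arc `u → sink i`, no source of the block adjacent to `sink i`
  have hfar_i := hfar i
  have hnot_u_sink : ∀ b, N.src b = u → N.tgt b ≠ N.sink i := by
    intro b hbu hbt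
    have h1 : N.graph.Adj (N.source i) u := by
      rw [← hai, hu]; exact codingVolume_adj_arc ai
    have h2 : N.graph.Adj u (N.sink i) := by rw [← hbu, ← hbt]; exact codingVolume_adj_arc b
    have hw := codingVolume_le_length_of_far hfar_i
      (SimpleGraph.Walk.cons h1 (SimpleGraph.Walk.cons h2 SimpleGraph.Walk.nil))
    simp at hw
  have hnot_blk_sink : ∀ b j, N.src b = N.source j → N.tgt b = N.sink i → j ∉ Blk := by
    rintro b j hbj hbt ⟨-, a, ha, hat, -⟩
    have h1 : N.graph.Adj (N.source i) u := by
      rw [← hai, hu]; exact codingVolume_adj_arc ai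
    have h2 : N.graph.Adj (N.source j) u := by rw [← ha, ← hat]; exact codingVolume_adj_arc a
    have h3 : N.graph.Adj (N.source j) (N.sink i) := by
      rw [← hbj, ← hbt]; exact codingVolume_adj_arc b
    have hw := codingVolume_le_length_of_far hfar_i
      (SimpleGraph.Walk.cons h1 (SimpleGraph.Walk.cons h2.symm
        (SimpleGraph.Walk.cons h3 SimpleGraph.Walk.nil)))
    simp at hw
  -- decode at `sink i` and apply `h ∘ g ∘ f`
  have hd := hdec i
  have himg : ∀ ψ ∈ span K (φ '' ↑(N.inArcs (N.sink i))), h (g (f ψ)) ∈ Tgt := by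
    intro ψ hψ
    induction hψ using span_induction with
    | mem z hz =>
      obtain ⟨b, hb, rfl⟩ := hz
      simp only [Finset.mem_coe, KPairsNet.inArcs, Finset.mem_filter, Finset.mem_univ,
        true_and] at hb
      by_cases hsb : ∃ j, N.src b = N.source j
      · obtain ⟨j, hj⟩ := hsb
        have hφb := codingVolume_label_source hloc b hj
        rw [mem_span_singleton] at hφb
        obtain ⟨c0, hc0⟩ := hφb
        rw [← hc0, map_smul, map_smul, map_smul]
        refine smul_mem _ _ ?_
        rw [hf j]
        by_cases hjr : j ∈ {j | hr j < r}
        · rw [if_pos hjr, map_zero, map_zero]; exact zero_mem _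
        rw [if_neg hjr, hg j]
        by_cases hjA : j ∈ {j | j ∉ A1}
        · rw [if_pos hjA, map_zero]; exact zero_mem _
        rw [if_neg hjA, hh j, if_pos (show j ∈ {j | j ∉ Blk} from hnot_blk_sink b j hj hb)]
        exact zero_mem _
      · push Not at hsb
        rcases lt_trichotomy (N.rank (N.src b)) r with hlt | heq | hgt
        · have hsup : φ b ∈ span K ((fun i => (LinearMap.proj i : Module.Dual K (ι → K))) ''
              {j | hr j < r}) := by
            cases r with
            | zero => exact absurd hlt (Nat.not_lt_zero _)
            | succ r' =>
              refine span_mono (Set.image_mono ?_)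
                (codingVolume_label_support hloc r' b hsb (Nat.lt_succ_iff.mp hlt))
              rintro j ⟨a', ha', hM', hrk, hz'⟩
              exact Nat.lt_succ_of_le ((hhr j a' ha' hM' hz').trans hrk)
          rw [codingVolume_kill_eq_zero_of_mem_span hf subset_rfl hsup, map_zero, map_zero]
          exact zero_mem _
        · rw [(hblock b hsb heq).2 (fun hbu => hnot_u_sink b hbu hb)]
          exact zero_mem _
        · exact hTgt_h _ (codingVolume_level_lemmaM hloc hr hhr r hf A1 hg hA1 b hsb hgt)
    | zero => rw [map_zero, map_zero, map_zero]; exact zero_mem _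
    | add x y _ _ hx hy => rw [map_add, map_add, map_add]; exact add_mem hx hy
    | smul c x _ hx => rw [map_smul, map_smul, map_smul]; exact smul_mem _ _ hx
  rw [← hfix]
  exact himg _ hd

end Level

end Summit.PneNP.PneNP.Theorems
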